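import Summits.QuantumFields.YangMills.Theorems.BalabanUVNodesN10B13KernelTowerWalksEntrywiseNumeralsDecoratedDialsLocated
import Summits.QuantumFields.YangMills.Theorems.BalabanUVNodesN10B13KernelTowerWalksEntrywiseDecorated
import Literature.MathematicalPhysics.QuantumFieldTheory.Balaban1983to89.B13CountBinderObstruction

/-!
# BalabanUVNodes ∕ N10 AT THE DECORATED KERNEL TOWER OF RECORD — the ALL-LOCATED junction 67RDL of [Balaban1988RG2Cluster] Lemmas 1–3 at the layer
# `lamD.toC.toK.layer` of a DECORATED residual layer `lamD : Node00.ResidB13D θ`, DIAL-WEIGHTED-VOLUME EDITION («67V»): the θ-FREE count binder `hcount`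
# of 67 ∕ 67R ∕ 67RD ∕ 67RDL REPLACED by the volume binder in its DIAL-WEIGHTED form (the text of `…EntrywiseDecorated`'s `hvol` at n10-w1's canonical
# letters), and the exchange letter `θ₀` FREE again (`0 < θ₀ ≤ θ₀max` instead of 67RD's `θ₀ := θ₀max`)
# (Track A, DAG node N10 [B13]; D-0149 width seat `pub-ymgap-dag-n10-w3` g4 — the located repair named by this seat's `B13CountBinderObstruction` (p612518),
# over n10-c's 67 (p587126) ∕ this seat's 67R (p599276) ∕ 67RD (p604591) ∕ n10-w4's 67RDL (p607696) and `…EntrywiseDecorated` BY NAME)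

WHY.  `Literature/…/B13CountBinderObstruction` (this seat, g4): the junction of record's binders `hN` (Lemma-3 numerics ⟹ `a₅ < δ·ℓ·κ∕64`), `hPcard` (`card Λ ≥ |P|`)
and the θ-FREE count `hcount : 2·card Λ + ½·card(Λ ⊕ C₀) + 2K₀α₄·#⋃𝐃 ≤ a₅·|Z|` — read at `Z =` the whole coarse torus and the admissible term `(∅, all bonds)` —
force `1280·(m₃+1)⁴·(ℓ₆+1)³ < c.δ·c.κ`, and every numerics witness of the chain (lit-balaban `consts`, n10-w1 `constsQ8`, n10-w3 `constsQ8A`: `δκ < 672`) violates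
it: 67 ∕ 67R ∕ 67RD ∕ 67RDL have NO joint inhabitant at any typed constants family (`no_joint_inhabitant_of_constsQ8A`).  The obstruction is an artefact of ONE
display choice: module 64 ∕ 67 adopted the CONCLUSION of n10-w1's `B13Bound226Numerals.vol_of_counts` — the volume binder with its per-row-bond coefficients
FROZEN at their worst cases `2, ½` — as THE binder, while the junction underneath (`…EntrywiseDecorated.b13LeafOfRecord_decLayer_of_located_entrywise`, module 62 ∕ the
51C lineage) displays the volume binder of (2.24)–(2.26) with DIAL-WEIGHTED coefficients (`x(1 + (1−x)⁻¹)` with `x ∝ θ₀`, `A·c_E` and `A·V′` with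
`A = 2ϑ·fib + γ₂ + 2m′α₄M⁻⁴(1 + 32∕(κ₁−1))⁴`) — print's p. 20 *"O(1)(LM)⁴α₅ + exp(−½(κ₁ − 1)) is sufficiently small"*: the smallness is the DIALS', so a term
with many row bonds is paid for by small `θ₀ ∕ γ₂ ∕ α₄M⁻⁴`, not by a large `a₅` (`B13CountBinderObstruction.dialCount_le_of_dials`).  67RD's `θ₀ := θ₀max` (this
seat's g2 — a legitimate WLOG for 67-as-typed, whose `hcount` hides the θ₀-dependence) then locks the worst case in.  THIS FILE is 67RDL with exactly that one
display choice undone: `hcount` ↦ `hvol` (dial-weighted, at w1's canonical letters — rates `chainRate j κ_C⋆`, `ϑ := theta m ν κ_C⋆ K̄ (8∕m_{A,0}) θ₀`, `K_G := K̄`,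
`K_Cs := 8∕m_{A,0}`, `c_E := 2∕m_{A,0}`), and `hθ₀def : θ₀ = θ₀max` ↦ `hθ₀ : 0 < θ₀`, `hθle : θ₀ ≤ θ₀max`.  Every other binder VERBATIM 67RDL's, in its order;
conclusion `B13LeafOfRecord θ lamD.toC.toK.layer` BY NAME.  NOTHING LOST relative to print, and NOTHING WEAKER than 67RDL for a consumer holding `hcount`:
`vol_of_counts` turns `hcount` + `hθle hγle hM4` into `hvol` (so 67RDL is this theorem ∘ `vol_of_counts`, up to `θ₀ := θ₀max`).

WHAT A CONSUMER NOW SUPPLIES for the volume factor: the dial-weighted count at each term `t ∈ terms L (m₃+1) Z` — for objects with `card Λ_t`, `card C₀,t`,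
`#⋃𝐃_t` bounded by a multiple of `|Z|` (true for print's terms: row bonds ⊆ bonds of `Z̃`), it holds once `θ₀`, `γ₂`, `α₄M⁻⁴` are small against `a₅` over that
multiple — a choice of DIALS, compatible with `hθle hγle hM4` (upper bounds only) and with `hαloc ∕ hRσloc` (smaller `θ₀` ⟹ larger located `R_σ`, a torus-size
condition on the record).  So the joint inhabitant of the N10 junction (director-ym №189 A6 rule) is an engineering item again; it is NOT built here.

HONEST FRAMING.  Count-neutral kernel bookkeeping BY NAME over LANDED modules (`…EntrywiseDecorated` + the numerals ∕ rates ∕ dials ∕ located-objects supply lemmas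
of n10-w1 ∕ n10-w3 ∕ n10-w4, each cited by name, none restated); nothing of Bałaban's `Δ_k`, `G_k(U)`, `Q`, averaging operators is constructed or asserted
(NODE 00 ∕ N06 ∕ def-Y ∕ def-T own them); NODE A's ENTRYWISE letters `hEL`, the Lemma 1–2 located inputs about the HIDDEN frame (N09 ∕ N07 ∕ N06 in-edges), the
reference package `rf` (NODE O's currency) and the numerics REMAIN HYPOTHESES; the ₁₃ pin algebra (dag-n10-d, PIN-ALGEBRA ONE-DECLARER) untouched.  67 ∕ 67R ∕
67RD ∕ 67RDL stand TRUE AS STATED (this is a sibling edition, not a replacement; which edition the lane's junction OF RECORD is, is the lane owner's word).  N10 NOT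
discharged; K1⁷ NOT closed; counts unmoved; one finite four-torus programme at fixed ε per run; nothing continuum ∕ ℝ⁴ ∕ OS ∕ mass-gap ∕ Clay.  0 `sorry`, 0 `def`,
standard axioms.  Filed `--kind proof --supports` K1⁷ «StabilityBAtRecordR13SepCoPH» (stmt-QuantumFields-20542) `--as helper` of route «BalabanUVNodes».

WHAT THIS FILE PROVES.  §1 `b13LeafOfRecord_decLayer_of_located_entrywise_numerals_dials_located_vol` ⟹ `B13LeafOfRecord θ lamD.toC.toK.layer`.  Proof: 67RDL's
slope `0 < M₁`; 67RD's package facts with `θ₀ ≤ θ₀max ≤ 1 < 4K̄ + 4` for the FREE `θ₀` and `B13RungDialNumerals.rung_dials_at`; 67R's `numerals_nodeA_of_dials`;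
64 ∕ 67's `B13Bound226Numerals.numerals_226_canonical` for the rate chain, `ϑ`, `hθR1le hsmallKθ hc0 hαc hsmall` — and NOT `vol_of_counts`; then
`…EntrywiseDecorated.b13LeafOfRecord_decLayer_of_located_entrywise` positionally (131 explicit binders) with n10-w4's eight located-object supply terms.

References (TYPES and page anchors only): [II] = [Balaban1988RG2Cluster] Lemma 1 p.9, Lemma 2 p.11, Lemma 3 p.20, p.3, (1.11) p.5, (2.3) p.12, (2.5)–(2.8) pp.12–14,
p.13, p.15, (2.14)–(2.26) pp.15–17, p.20 (before (2.37)), p.21; [I] = [Balaban1987RG1] (1.11)–(1.14) p.262; [B9] = [Balaban1985BackgroundPropagators] Thm 3.10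
(3.107)–(3.108) p.416, Thm 3.12 p.423, p.428; [Balaban1984PropagatorsII] Lemma 2.1 (2.61) p.234.
A2 ∕ A6.  The two new binder texts are inhabited where 67RDL's were: `hθ₀ ∕ hθle` by `θ₀ := θ₀max` (`theta0Max_pos`, `le_rfl`); `hvol` at any data meeting 67RDL's
`hcount` by `vol_of_counts` (so every block-by-block inhabitant of 67RDL's binders is one of this file's) — and, unlike `hcount`, ALSO at terms with many row bonds
by small dials (`B13CountBinderObstruction.dialCount_le_of_dials`); a single inhabitant of all binders at once is NOT claimed here (it is the engineering item this
edition re-opens).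
-/

noncomputable section

namespace Summit.QuantumFields.YangMills.BalabanUVNodes.N10B13KernelTowerWalksEntrywiseNumeralsDecoratedDialsLocatedVol

open Literature.MathematicalPhysics.QuantumFieldTheory.Balaban1983to89
open Literature.MathematicalPhysics.QuantumFieldTheory.Balaban1983to89.DagBinding
open Literature.MathematicalPhysics.QuantumFieldTheory.Balaban1983to89.Node00
open Literature.MathematicalPhysics.QuantumFieldTheory.Balaban1983to89.B13Lemma3Torus (TwoTorusStep)
open Literature.MathematicalPhysics.QuantumFieldTheory.Balaban1983to89.B13Lemma3TorusSocket (TermDomination Lemma3Numerics)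
open Literature.MathematicalPhysics.QuantumFieldTheory.Balaban1983to89.B13Lemma3TorusData
open Metric
open Literature.MathematicalPhysics.QuantumFieldTheory.Balaban1983to89.B16Absorption (pbox)
open Literature.MathematicalPhysics.QuantumFieldTheory.Balaban1983to89.TreeLengthTorus
open Literature.MathematicalPhysics.QuantumFieldTheory.Balaban1983to89.TreeLengthTorusGeometry
open Literature.MathematicalPhysics.QuantumFieldTheory.Balaban1983to89.TreeLengthTorusTransfer
open Literature.MathematicalPhysics.QuantumFieldTheory.Balaban1983to89.B12TreeDecay (kappa₀ K₀)
open Literature.MathematicalPhysics.QuantumFieldTheory.Balaban1983to89.B13PkScaling (Qop scaled)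
open Literature.MathematicalPhysics.QuantumFieldTheory.Balaban1983to89.B13Bound143 (invTau R12)
open Literature.MathematicalPhysics.QuantumFieldTheory.Balaban1983to89.B13Term214 (term214 SepHolOn core214 F214)
open Literature.MathematicalPhysics.QuantumFieldTheory.Balaban1983to89.B13Lemma3TorusTerms (terms Z0)
open Literature.MathematicalPhysics.QuantumFieldTheory.Balaban1983to89.B5TorusCover (UT)
open Literature.MathematicalPhysics.QuantumFieldTheory.Balaban1983to89.B13TermWalkData (TermKernels)
open Literature.MathematicalPhysics.QuantumFieldTheory.Balaban1983to89.NodeOLettersOfWalksAcross (WalkPackage TermWalks)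
open Literature.MathematicalPhysics.QuantumFieldTheory.Balaban1983to89.NodeOLettersOfWalksPerturbative (RefPackage TermWalksRef)
open Literature.MathematicalPhysics.QuantumFieldTheory.Balaban1983to89.B13Sqrt27Accretive (invSqrt)
open Literature.MathematicalPhysics.QuantumFieldTheory.Balaban1983to89.B9Thm37GlueTorus (tdist1)
open Literature.MathematicalPhysics.QuantumFieldTheory.Balaban1983to89.B13Eq111SDecoupling (sDecorate)
open Literature.MathematicalPhysics.QuantumFieldTheory.Balaban1983to89.B13EntrywiseWalks (RawEntryLetters GeodesicDecoration rawEntryTerm)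
open scoped Matrix
open Literature.MathematicalPhysics.QuantumFieldTheory.Balaban1983to89.B13Bound226Numerals
  (theta0Max gamma2Max m4Min theta chainRate coefQ coefQ' dSum theta0Max_pos coefQ_nonneg coefQ'_nonneg dSum_pos_and_le numerals_226_canonical)
open Literature.MathematicalPhysics.QuantumFieldTheory.Balaban1983to89.B13EntrywiseBlockNumerals (kbarFloor numerals_nodeA_of_dials)
open Literature.MathematicalPhysics.QuantumFieldTheory.Balaban1983to89.B13RungDialNumerals (radiusStar alphaMax rsigmaMin radiusStar_pos rung_dials_at)
open Literature.MathematicalPhysics.QuantumFieldTheory.Balaban1983to89.NodeOLettersOfWalksAcross.WalkPackage (kapCStar_spec rhoE_pos mu_pos Kbar_nonneg)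
open Literature.MathematicalPhysics.QuantumFieldTheory.Balaban1983to89.NodeOLettersOfWalksPerturbative.RefPackage (admissible_toWalkPackage cV_nonneg cV₀_nonneg)
open Literature.MathematicalPhysics.QuantumFieldTheory.Balaban1983to89.B13CondTowerAccretiveFloorMax (accretiveFloorMax hKacc_decTower_of_le_accretiveFloorMax)
open Literature.MathematicalPhysics.QuantumFieldTheory.Balaban1983to89.B13CondTowerLocationNumerals
  (locNFibreMax sigmaDistFloor locFFibreMax decorExcess cmAbsMax cmRange hfibN_decTower_of_le hKmult_decTower_of_le hKfar_decTower_of_le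
    hfibF_of_locFFibreMax_le hGJ_of_laws_of_decorExcess_le hCle_of_cmAbsMax_le_one hCsupp_of_cmRange_le)
open Summit.QuantumFields.YangMills.BalabanUVNodes.N10B13KernelTowerWalksEntrywiseDecorated (b13LeafOfRecord_decLayer_of_located_entrywise)

/-! ## §1. THE ENTRYWISE JUNCTION AT THE DECORATED TOWER, ALL-LOCATED, DIAL-WEIGHTED-VOLUME EDITION -/

/-- `θ₀max ≤ 1` from the signs of its ingredients (`Q, Q′ ≥ 0`, `D > 0`): the free exchange letter `θ₀ ≤ θ₀max` is `< 4K̄ + 4`, as `rung_dials_at` wants.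
[cite: Balaban1988RG2Cluster, (2.24) p.17, bookkeeping] -/
theorem theta0Max_le_one_of_signs {m ν : ℕ} {κs KG KCs cE BΓ cV c0η mA : ℝ} (hQ : 0 ≤ coefQ m ν κs KG KCs)
    (hQ' : 0 ≤ coefQ' m ν κs KG KCs) (hD : 0 < dSum m ν cE BΓ cV c0η mA) : theta0Max m ν κs KG KCs cE BΓ cV c0η mA ≤ 1 := by
  unfold theta0Max
  exact div_le_one_of_le₀ (by nlinarith [mul_nonneg hD.le hQ']) (by positivity)

section DecLayer

variable (θ : Stage3Params) (lamD : ResidB13D θ)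

-- the junction elaborates ≈ 150 binders and a 160–170-argument application; twice the default budget (as the source junctions 67 ∕ 67R ∕ 67RD ∕ 67RDL)
set_option maxHeartbeats 400000 in
open Classical in
/-- **THE [B13] LEAF AT THE DECORATED KERNEL TOWER OF RECORD (ENTRYWISE, ALL-LOCATED, DIAL-WEIGHTED VOLUME).**  n10-w4's 67RDL
`b13LeafOfRecord_decLayer_of_located_entrywise_numerals_dials_located` with TWO binder texts changed and nothing else: (i) the θ-FREE count
`hcount : 2·card Λ + ½·card(Λ ⊕ C₀) + 2K₀α₄·#⋃𝐃 ≤ a₅|Z|` ↦ the DIAL-WEIGHTED volume binder `hvol` of `…EntrywiseDecorated` at n10-w1's canonical letters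
(coefficients `x(1 + (1−x)⁻¹)` with `x = (8∕m_{A,0})·fib₃·ϑ·fib₁ ∝ θ₀`, and `A·(2∕m_{A,0})`, `A·(1 + …)` with `A = 2ϑ·fib₁ + γ₂ + 2m′α₄M⁻⁴(1 + 32∕(κ₁−1))⁴`); (ii) 67RD's
`hθ₀def : θ₀ = θ₀max` ↦ `hθ₀ : 0 < θ₀`, `hθle : θ₀ ≤ θ₀max`.  WHY: with the frozen `hcount` the junction has no joint inhabitant at any typed constants family
(`B13CountBinderObstruction.no_joint_inhabitant_of_constsQ8A`: `hN ∧ hPcard ∧ hcount ⟹ 1280(m₃+1)⁴(ℓ₆+1)³ < δκ`, witness families `δκ < 672`), whereas the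
dial-weighted count is met for any object sizes by small dials (`dialCount_le_of_dials`) — print's p. 20 «O(1)(LM)⁴α₅ sufficiently small».  67RDL = this ∘ `vol_of_counts`
(up to `θ₀ := θ₀max`), so nothing is lost for a consumer holding `hcount`.  Conclusion `B13LeafOfRecord θ lamD.toC.toK.layer` BY NAME; count-neutral: hypotheses about the
HIDDEN frame, NODE A's letters `hEL`, NODE O's package `rf` and the numerics remain; nothing of Bałaban's is asserted.
[cite: Balaban1988RG2Cluster, Lemma 1 p.9, Lemma 2 p.11, Lemma 3 p.20, p.3, (1.11) p.5, (2.3) p.12, (2.5)–(2.8) pp.12–14, p.13, (2.14)–(2.26) pp.15–17, p.15, p.20 (before (2.37));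
Balaban1987RG1, (1.11)–(1.14) p.262; Balaban1985BackgroundPropagators, Thm 3.10 (3.107)–(3.108) p.416, Thm 3.12 p.423, p.428; Balaban1984PropagatorsII, Lemma 2.1 (2.61) p.234] -/
theorem b13LeafOfRecord_decLayer_of_located_entrywise_numerals_dials_located_vol
    (hN12 : 12 ≤ (θ.ℓ₆ + 1) * (lamD.toC.toK.layer.n + 1))
    -- (1) LEMMA 1: [I]'s block geometry of the (1.33) index families of the layer
    (dist : TDom 4 ((θ.ℓ₆ + 1) * (lamD.toC.toK.layer.n + 1)) → TPt 4 ((θ.ℓ₆ + 1) * (lamD.toC.toK.layer.n + 1)) → (j : ℕ) →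
      TPt 4 ((θ.ℓ₆ + 1) ^ (lamD.toC.toK.layer.k - j) * ((θ.ℓ₆ + 1) * (lamD.toC.toK.layer.n + 1))) → ℝ)
    {K K' : ℝ}
    (hS0Y : ∀ Y, ∀ a ∈ lamD.toC.toK.layer.S0 Y,
      (pbox (fun i => natLift a i - (5 : ℕ)) (fun i => natLift a i + 1 + (5 : ℕ))).image (proj ((θ.ℓ₆ + 1) * (lamD.toC.toK.layer.n + 1))) ⊆ Y.1)
    (hFsub : ∀ Y a, lamD.toC.toK.layer.F Y a ⊆
      (pbox (fun i => natLift a i - (5 : ℕ)) (fun i => natLift a i + 1 + (5 : ℕ))).image (proj ((θ.ℓ₆ + 1) * (lamD.toC.toK.layer.n + 1))) \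
        (pbox (fun i => natLift a i - (4 : ℕ)) (fun i => natLift a i + 1 + (4 : ℕ))).image (proj ((θ.ℓ₆ + 1) * (lamD.toC.toK.layer.n + 1))))
    (hSq : ∀ Y, ∀ a ∈ lamD.toC.toK.layer.S0 Y, ∀ j, lamD.toC.toK.layer.Sq Y a j ⊆
      (Finset.univ : Finset (TPt 4 ((θ.ℓ₆ + 1) ^ (lamD.toC.toK.layer.k - j) * ((θ.ℓ₆ + 1) * (lamD.toC.toK.layer.n + 1))))).filter
        (fun q => tcoarse ((θ.ℓ₆ + 1) ^ (lamD.toC.toK.layer.k - j)) ((θ.ℓ₆ + 1) * (lamD.toC.toK.layer.n + 1)) q ∈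
          (pbox (fun i => natLift a i - (2 : ℕ)) (fun i => natLift a i + 1 + (2 : ℕ))).image (proj ((θ.ℓ₆ + 1) * (lamD.toC.toK.layer.n + 1)))))
    (hScY : ∀ Y, lamD.toC.toK.layer.Sc Y ⊆ Y.1) (hdist0 : ∀ Y a j q, 0 ≤ lamD.toC.toK.layer.c.δ₀ * dist Y a j q)
    (hdist : ∀ Y a j (n : ℕ) q, q ∉ (pbox (fun i => (((θ.ℓ₆ + 1) ^ (lamD.toC.toK.layer.k - j) : ℕ) : ℤ) * natLift a i - (n + 1 : ℕ))
      (fun i => (((θ.ℓ₆ + 1) ^ (lamD.toC.toK.layer.k - j) : ℕ) : ℤ) * natLift a i + 2 * (((θ.ℓ₆ + 1) ^ (lamD.toC.toK.layer.k - j) : ℕ) : ℤ) - 1 + (n + 1 : ℕ))).image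
        (proj ((θ.ℓ₆ + 1) ^ (lamD.toC.toK.layer.k - j) * ((θ.ℓ₆ + 1) * (lamD.toC.toK.layer.n + 1)))) → lamD.toC.toK.layer.c.δ₀ * lamD.toC.toK.layer.c.M * ((n : ℝ) + 1) ≤ lamD.toC.toK.layer.c.δ₀ * dist Y a j q)
    (hSX : ∀ Y a j q, lamD.toC.toK.layer.SX Y a j q ⊆ (tcubeSys 4 ((θ.ℓ₆ + 1) ^ (lamD.toC.toK.layer.k - j) * ((θ.ℓ₆ + 1) * (lamD.toC.toK.layer.n + 1)))).above q)
    (hSX' : ∀ Y a j q, lamD.toC.toK.layer.SX' Y a j q ⊆ (tcubeSys 4 ((θ.ℓ₆ + 1) ^ (lamD.toC.toK.layer.k - j) * ((θ.ℓ₆ + 1) * (lamD.toC.toK.layer.n + 1)))).above q)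
    (hX0 : ∀ Y, ∀ a ∈ lamD.toC.toK.layer.Sc Y, ∀ j ∈ Finset.range (lamD.toC.toK.layer.k + 1), ∀ q ∈ lamD.toC.toK.layer.Sq' Y a j, ∀ x ∈ lamD.toC.toK.layer.SX' Y a j q,
      x.1.image (tcoarse ((θ.ℓ₆ + 1) ^ (lamD.toC.toK.layer.k - j)) ((θ.ℓ₆ + 1) * (lamD.toC.toK.layer.n + 1))) ⊆ Y.1)
    -- (1) LEMMA 1: per-term analyticity on (1.34)
    (hAnT : ∀ Y, ∀ a ∈ lamD.toC.toK.layer.S0 Y, ∀ X ∈ (lamD.toC.toK.layer.F Y a).powerset, ∀ j ∈ Finset.range (lamD.toC.toK.layer.k + 1), ∀ q ∈ lamD.toC.toK.layer.Sq Y a j,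
      ∀ x ∈ lamD.toC.toK.layer.SX Y a j q, AnalyticOnNhd ℂ (lamD.toC.toK.layer.T Y a X j q x) (lamD.toC.toK.layer.sp1 Y))
    (hAnT' : ∀ Y, ∀ a ∈ lamD.toC.toK.layer.Sc Y, ∀ j ∈ Finset.range (lamD.toC.toK.layer.k + 1), ∀ q ∈ lamD.toC.toK.layer.Sq' Y a j, ∀ x ∈ lamD.toC.toK.layer.SX' Y a j q,
      AnalyticOnNhd ℂ (lamD.toC.toK.layer.T' Y a j q x) (lamD.toC.toK.layer.sp1 Y))
    -- (1) LEMMA 1: thresholds and restrictions on the residual constants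
    (hK : 0 ≤ K) (hK' : 0 ≤ K') (hκ : 0 ≤ lamD.toC.toK.layer.c.κ) (hδ1 : lamD.toC.toK.layer.c.δ < 1)
    (hδκ : 1 ≤ lamD.toC.toK.layer.c.δ * lamD.toC.toK.layer.c.κ) (hκ126 : kappa₀ 64 8 ≤ lamD.toC.toK.layer.c.κ)
    (hκ126' : kappa₀ 64 8 ≤ lamD.toC.toK.layer.c.δ * lamD.toC.toK.layer.c.κ) (hκ₁ : 1 + 2 * Real.log (8 * 12 ^ 3) ≤ lamD.toC.toK.layer.c.κ₁)
    (hκ₁' : 2 + 16 * Real.log 128 ≤ lamD.toC.toK.layer.c.κ₁) (hδ₀M : 10 * Real.exp (-1) ≤ lamD.toC.toK.layer.c.δ₀ * lamD.toC.toK.layer.c.M)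
    (hδ₀M5 : 2 * Real.log 5 ≤ lamD.toC.toK.layer.c.δ₀ * lamD.toC.toK.layer.c.M)
    (hR8 : (1 - lamD.toC.toK.layer.c.δ) * lamD.toC.toK.layer.c.κ ≤ (1 / 4) * (lamD.toC.toK.layer.c.κ₁ - 1))
    (hR9 : (1 - 2 * lamD.toC.toK.layer.c.δ) * lamD.toC.toK.layer.c.κ ≤ (1 / 16) * lamD.toC.toK.layer.c.κ₁)
    -- (1) LEMMA 1: per-term (1.24), (1.30) by reference to [I] (3.54), (3.17), [15] Prop. 4, [13] (3.108); the constants with headroom (1 − θ₁)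
    (h124 : ∀ Y φ, φ ∈ lamD.toC.toK.layer.sp1 Y → ∀ a ∈ lamD.toC.toK.layer.S0 Y, ∀ X ∈ (lamD.toC.toK.layer.F Y a).powerset, ∀ j ∈ Finset.range (lamD.toC.toK.layer.k + 1), ∀ q ∈ lamD.toC.toK.layer.Sq Y a j,
      ∀ x ∈ lamD.toC.toK.layer.SX Y a j q,
        ‖lamD.toC.toK.layer.T Y a X j q x φ‖ ≤ K * (((θ.ℓ₆ + 1 : ℕ) : ℝ) ^ j * (((θ.ℓ₆ + 1 : ℕ) : ℝ) ^ lamD.toC.toK.layer.k)⁻¹) ^ 5 *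
          Real.exp (-(lamD.toC.toK.layer.c.κ₁ - 1) *
            (((Y.1 \ (pbox (fun i => natLift a i - (5 : ℕ)) (fun i => natLift a i + 1 + (5 : ℕ))).image
              (proj ((θ.ℓ₆ + 1) * (lamD.toC.toK.layer.n + 1)))).card : ℝ) + X.card)) *
          Real.exp (-(lamD.toC.toK.layer.c.κ * torusTreeLen x.1)))
    (h130 : ∀ Y φ, φ ∈ lamD.toC.toK.layer.sp1 Y → ∀ a ∈ lamD.toC.toK.layer.Sc Y, ∀ j ∈ Finset.range (lamD.toC.toK.layer.k + 1), ∀ q ∈ lamD.toC.toK.layer.Sq' Y a j,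
      ∀ x ∈ lamD.toC.toK.layer.SX' Y a j q,
        ‖lamD.toC.toK.layer.T' Y a j q x φ‖ ≤ K' * Real.exp (-(1 / 2) * (lamD.toC.toK.layer.c.δ₀ * lamD.toC.toK.layer.c.M) * (((θ.ℓ₆ + 1 : ℕ) : ℝ) ^ j * (((θ.ℓ₆ + 1 : ℕ) : ℝ) ^ lamD.toC.toK.layer.k)⁻¹)⁻¹
            - (1 / 2) * lamD.toC.toK.layer.c.δ₀ * dist Y a j q) *
          Real.exp (-(lamD.toC.toK.layer.c.κ₁ - 1) * ((Y.1 \ x.1.image (tcoarse ((θ.ℓ₆ + 1) ^ (lamD.toC.toK.layer.k - j)) ((θ.ℓ₆ + 1) * (lamD.toC.toK.layer.n + 1)))).card : ℝ)) *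
          Real.exp (-(lamD.toC.toK.layer.c.κ * torusTreeLen x.1)))
    {θ₁ : ℝ} (hθ₁0 : 0 ≤ θ₁) (hθ₁1 : θ₁ < 1)
    (hC : K * K₀ 64 8 * (2 * (6 * ((θ.ℓ₆ + 1 : ℕ) : ℝ)) ^ 4) * Real.exp 1 * Real.exp ((1 / 8) * lamD.toC.toK.layer.c.κ₁ * (12 ^ 4 - 1)) +
        2 * (64 * K') * K₀ 64 8 * 1344 ≤
      (1 - θ₁) * (lamD.toC.toK.layer.c.E₀ * lamD.toC.toK.layer.c.ε₁ * lamD.toC.toK.layer.c.C₁ * lamD.toC.toK.layer.c.M ^ lamD.toC.toK.layer.c.q * Real.exp (lamD.toC.toK.layer.c.C₂ * lamD.toC.toK.layer.c.κ₁)))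
    -- (2) LEMMA 2 (pp. 10–11): the curvature terms; the located per-term data of `B13Lemma2Torus.lemma2Printed_twoTorus'` for the layer's plaquette data
    (hGlAn : ∀ Y, AnalyticOnNhd ℂ (lamD.toC.toK.layer.Gl Y) (lamD.toC.toK.layer.sp1 Y))
    (hGl : ∀ Y φ, φ ∈ lamD.toC.toK.layer.sp1 Y → ‖lamD.toC.toK.layer.Gl Y φ‖ ≤ θ₁ * (lamD.toC.toK.layer.c.E₀ * lamD.toC.toK.layer.c.ε₁ * lamD.toC.toK.layer.c.C₁ * lamD.toC.toK.layer.c.M ^ lamD.toC.toK.layer.c.q * Real.exp (lamD.toC.toK.layer.c.C₂ * lamD.toC.toK.layer.c.κ₁)) *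
      Real.exp (-((1 - 2 * lamD.toC.toK.layer.c.δ) * lamD.toC.toK.layer.c.κ * (tsys 4 ((θ.ℓ₆ + 1) * (lamD.toC.toK.layer.n + 1))).dj Y)))
    (he : ∀ Y b, ‖lamD.toC.toK.layer.e Y b‖ ≤ 1) (hg : lamD.toC.toK.layer.g ≠ 0) {R K₂ : ℝ} {m₂ : ℕ} (hK₂ : 0 ≤ K₂) (hR : 0 < R)
    (hε3 : 3 * lamD.toC.toK.layer.c.ε₁ ≤ R)
    (hW : ∀ Y, ∀ i ∈ lamD.toC.toK.layer.s Y, ∀ φ ∈ lamD.toC.toK.layer.sp1 Y, AnalyticOnNhd ℂ (lamD.toC.toK.layer.Wf Y i φ) (ball 0 R))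
    (hKW : ∀ Y, ∀ i ∈ lamD.toC.toK.layer.s Y, ∀ φ ∈ lamD.toC.toK.layer.sp1 Y, ∀ z ∈ ball (0 : lamD.toC.toK.layer.E) R,
      ‖lamD.toC.toK.layer.Wf Y i φ z‖ ≤ K₂ * Real.exp (-(lamD.toC.toK.layer.c.κ₁ - 1) * ((Y.1.card : ℝ) - 1)) * ‖z‖ ^ 3)
    (hcard : ∀ Y, (lamD.toC.toK.layer.s Y).card ≤ m₂ * Y.1.card)
    (hsp : ∀ Y φ, φ ∈ lamD.toC.toK.layer.sp1 Y → ‖lamD.toC.toK.layer.g‖ * ‖lamD.toC.toK.layer.rd Y φ‖ < lamD.toC.toK.layer.c.ε₁)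
    (hfloor : 27 * m₂ * K₂ * Real.exp (lamD.toC.toK.layer.c.κ₁ - 1) ≤ lamD.toC.toK.layer.c.C₃ * lamD.toC.toK.layer.c.M ^ 4 * Real.exp (lamD.toC.toK.layer.c.C₂ * lamD.toC.toK.layer.c.κ₁))
    (hAnP : ∀ Y, ∀ i ∈ lamD.toC.toK.layer.s Y, AnalyticOnNhd ℂ (fun φ => scaled lamD.toC.toK.layer.g (lamD.toC.toK.layer.Wf Y i φ) (lamD.toC.toK.layer.rd Y φ)) (lamD.toC.toK.layer.sp1 Y))
    (hG : ∀ Y, lamD.toC.toK.layer.GaugeInv (lamD.toC.toK.layer.V Y) ∧ lamD.toC.toK.layer.GaugeInv ((WtOfRecord θ lamD.toC.toK.layer).toStepData.quadForm Y) ∧ lamD.toC.toK.layer.GaugeInv (lamD.toC.toK.layer.Vpp Y))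
    -- (3) LEMMA 3 (pp. 14–20): the signs of (2.18)–(2.20), R12, |τ(Y)| ≥ 2, and the numerics bundle at ℓ = ½L
    (hL8 : 8 ≤ θ.ℓ₆ + 1) {a a₂ a₂' a₅ Aabs : ℝ}
    (hN : Lemma3Numerics (c13OfRecord θ lamD.toC.toK.layer) (lamD.toC.toK.layer.m₃ + 1) (((θ.ℓ₆ + 1 : ℕ) : ℝ) / 2) a a₂ a₂' a₅ Aabs)
    (h12 : R12 (c13OfRecord θ lamD.toC.toK.layer)) (hE : 0 < lamD.toC.toK.layer.c.E₀) (hε : 0 < lamD.toC.toK.layer.c.ε₁)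
    (hC₁ : 0 < lamD.toC.toK.layer.c.C₁) (hα : 0 < lamD.toC.toK.layer.c.α₄) (hM : 1 ≤ lamD.toC.toK.layer.c.M)
    (hτ2 : lamD.toC.toK.layer.c.E₀ * lamD.toC.toK.layer.c.ε₁ * lamD.toC.toK.layer.c.C₁ * lamD.toC.toK.layer.c.α₄⁻¹ * lamD.toC.toK.layer.c.M ^ lamD.toC.toK.layer.c.q * Real.exp (lamD.toC.toK.layer.c.C₂ * lamD.toC.toK.layer.c.κ₁) ≤ 1 / 2)
    -- (3) the Cauchy radius and the parameter domains (p. 15)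
    -- the bigger σ-polydisc (a second constants record `cp` lending its `κ₁`; NODE A's kernels are tagged at `cp`) and a
    -- Cauchy radius `r ≤ 1`; the τ-regions are the open discs of radii `2|τ(Y)|` (chosen inside)
    (cp : B13.Consts) (hκp : lamD.toC.toK.layer.c.κ₁ < cp.κ₁) (hr : 0 < lamD.toC.toK.r) (hr1 : lamD.toC.toK.r ≤ 1)
    -- (3) THE DICTIONARY IS def-B13's KERNEL TOWER (`lamD.toC.toK.𝒦 ∕ uOf ∕ r ∕ lZ ∕ lD ∕ Gam ∕ chiY₀ ∕ chicP ∕ Pl ∕ rP ∕ Vr ∕ emb`, `Dfam := 𝐃`; `Γ(σ) = G(σ)·` is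
    --     `ResidB13K.Gam_eq`): only the configuration size `α` and the `|P|` row-bond count stay located
    {α : ℝ} (hαnn : 0 ≤ α)
    (huα : ∀ Z, ∀ t ∈ terms (θ.ℓ₆ + 1) (lamD.toC.toK.layer.m₃ + 1) Z, ∀ φ ∈ lamD.toC.toK.layer.sp2 Z, ‖lamD.toC.toK.uOf Z t φ‖ ≤ α)
    (hPcard : ∀ Z, ∀ t ∈ terms (θ.ℓ₆ + 1) (lamD.toC.toK.layer.m₃ + 1) Z, (lamD.toC.toK.Pl Z t).card = t.2.card)
    -- (3) the record's objects behind the terms: bonds, cubes, the real field inside the configurations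
    (ιb : (Z : TDom 4 (lamD.toC.toK.layer.n + 1)) → (t : Finset (TDom 4 ((θ.ℓ₆ + 1) * (lamD.toC.toK.layer.n + 1))) × Finset (TBond 4 (lamD.toC.toK.layer.m₃ + 1) ((θ.ℓ₆ + 1) * (lamD.toC.toK.layer.n + 1)))) → (lamD.toC.toK.𝒦 Z t).Λ → lamD.toC.toK.layer.Bond)
    (hι : ∀ Z t, Function.Injective (ιb Z t)) (cube : lamD.toC.toK.layer.Bond → TPt 4 ((θ.ℓ₆ + 1) * (lamD.toC.toK.layer.n + 1)))
    (hQsupp : ∀ (Y : TDom 4 ((θ.ℓ₆ + 1) * (lamD.toC.toK.layer.n + 1))) φ b b', lamD.toC.toK.layer.Q Y φ b b' ≠ 0 → cube b ∈ Y.1 ∧ cube b' ∈ Y.1) {m' : ℕ}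
    (hfibc : ∀ Z t (x : TPt 4 ((θ.ℓ₆ + 1) * (lamD.toC.toK.layer.n + 1))), (Finset.univ.filter fun j => cube (ιb Z t j) = x).card ≤ m')
    (hBv : ∀ Z t φ B b, lamD.toC.toK.layer.Bv (lamD.toC.toK.emb Z t φ B) (ιb Z t b) = (B b : ℂ))
    (hBv0 : ∀ Z t φ B b', b' ∉ Set.range (ιb Z t) → lamD.toC.toK.layer.Bv (lamD.toC.toK.emb Z t φ B) b' = 0)
    (hχsupp : ∀ Z, ∀ t ∈ terms (θ.ℓ₆ + 1) (lamD.toC.toK.layer.m₃ + 1) Z, ∀ φ ∈ lamD.toC.toK.layer.sp2 Z, ∀ B, lamD.toC.toK.chiY₀ Z t B ≠ 0 → ∀ Y ∈ t.1,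
      lamD.toC.toK.emb Z t φ B ∈ lamD.toC.toK.layer.sp1 Y)
    -- (3) measurability of the layer's potentials and small-field region in the bond variables (`χ_{k,Y₀}` of record IS measurable, §0)
    (hVm : ∀ Z t φ Y, Measurable (lamD.toC.toK.Vr Z t φ Y))
    (hsmallm : ∀ Z t φ, MeasurableSet {B : (lamD.toC.toK.𝒦 Z t).Λ → ℝ | ∀ Y ∈ t.1, lamD.toC.toK.emb Z t φ B ∈ lamD.toC.toK.layer.sp1 Y}) {γ₂ : ℝ}
    (hγ₂ : 0 ≤ γ₂)
    -- (3‴) uniform fibre bound of the bond locations AS A LOCATED INEQUALITY (n10-w4 g2 `B13CondTowerLocationNumerals.locNFibreMax`):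
    --      the largest location fibre of the record's `locN` is at most the letter `m` of the (2.24)–(2.26) numerals
    {m : ℕ} (hm : locNFibreMax lamD.toC ≤ m)
    -- (3) THE REFERENCE RUNG ON THE TERMS OF THE STEP OF RECORD (the displayed hypothesis, n10-b's reference currency):
    --     ONE admissible reference package `rf`, an accretivity radius `0 < R₁ < R`, print's two perturbative sources (p. 15:
    --     «O(1)e^{−⅓δ₀M} + O(α₀ + α₁)» against the reference positivity) as FOUR DIVISION-FREE THRESHOLDS, positive input
    --     rates and `η ≤ etaMax` of the W-walks package `rf.toWalkPackage R₁` (standard rate book: `κ_C = κ_C⋆`, `ρ′ = μ∕4`),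
    --     `TermWalksRef` for the kernels of every term, round letters, and PRINT's TWO EXCHANGE THRESHOLDS for a `θ₀ > 0`
    (rf : RefPackage) (hrf : rf.Admissible)
    -- (2″) THE RUNG's RADIUS DIAL AS n10-w3's LOCATED NUMERAL (`B13RungDialNumerals`): the accretivity radius IS `R₁⋆(rf)` — an EQUATION
    --      binder (discharge by `rfl`) so that the package numerals stay short; the exchange letter `θ₀` stays FREE in this edition (below)
    {R₁ : ℝ} (hR₁def : R₁ = radiusStar rf.R rf.m₀ rf.mA₀ rf.KbarP rf.KbarA rf.cV rf.cV₀)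
    (hp : (rf.toWalkPackage R₁).PositiveRates) (hη : rf.η ≤ (rf.toWalkPackage R₁).etaMax)
    -- (67V) THE EXCHANGE LETTER `θ₀` IS FREE AGAIN: `0 < θ₀ ≤ θ₀max` (67RD pinned `θ₀ := θ₀max`; the dial-weighted volume binder below is
    --       MONOTONE THE OTHER WAY in `θ₀`, so no WLOG is available — print's «α₅ sufficiently small», p. 20)
    {θ₀ : ℝ} (hθ₀ : 0 < θ₀)
    (hθle : θ₀ ≤ theta0Max m lamD.toC.toK.ν (rf.toWalkPackage R₁).kapCStar (rf.toWalkPackage R₁).Kbar (8 / rf.mA₀) (2 / rf.mA₀)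
      (rf.toWalkPackage R₁).BΓ rf.cV (B6.c0 1 rf.η) rf.mA₀)
    -- (2″) PRINT's TWO PERTURBATIVE SOURCES AS TWO LOCATED INEQUALITIES: «|A′|, |𝐉| small» ([II] p. 15) and «σ-cubes far from Z₀» (p. 13)
    (hαloc : α ≤ alphaMax θ₀ R₁ (rf.toWalkPackage R₁).Kbar)
    (hRσloc : rsigmaMin θ₀ (rf.toWalkPackage R₁).Kbar (rf.toWalkPackage R₁).mu (rf.toWalkPackage R₁).kapCStar rf.m₀ rf.mA₀ rf.KbarP rf.KbarA
      rf.cV rf.cV₀ rf.εP rf.εA ≤ rf.Rσ)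
    -- (3) NODE A's KERNEL DATA READ OFF ONE OPERATOR PER TERM — print's `C*Δ_k(σ(Z),𝐔,𝐉)C` after the conditioning (2.5)–(2.6): block
    --     reading; ONE expansion at `rf`'s full-precision letters whose terms are `s`-MONOMIALS times σ-free operators ([II] p. 3) and
    --     carry a WALK REVERSAL ([13] (3.107)); ONE positivity; geometry; dominations in `rf`
    (hKX : ∀ Z, ∀ t ∈ terms (θ.ℓ₆ + 1) (lamD.toC.toK.layer.m₃ + 1) Z, (lamD.toC.toK.𝒦 Z t).X.Nonempty)
    -- (3″) NODE A's OBJECT DATA AS ENTRYWISE LETTERS (census v5 class A2′ in its ENTRYWISE form ∧ A2″ as ONE geometric letter ∧ A2‴; replaces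
    --      module 21's `hKexp`; ym-nodeO-ideate P2 g30's reduction, tree module `B13EntrywiseWalks`): per term, the fine-bond index `lamD.P Z t` located by
    --      `locF`; TWO ENTRYWISE LETTERS of the σ-free fluctuation operator `lamD.Δ₀ Z t` on the complex `rf.R`-ball — (3.108)-type decay
    --      `‖Δ₀(u)_{ij}‖ ≤ B·e^{−ρ·d₁(i,j)}` and entrywise holomorphy (`RawEntryLetters`) —, a fibre bound; the cube decoration `J` on PAIRS of fine
    --      bonds with the GEODESIC letter (`|J(i,j)| ≤ c₀ + d₁(i,j)∕M₁`, a decorated pair joined by a `d₁`-geodesic through `(lamD.toC.toK.𝒦 Z t).X`); the (1.11)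
    --      numerics `0 < η ≤ ε < ρ`, `2κ₁ ≤ ηM₁`; the REAL constant local averaging operator `lamD.Cm Z t` of (2.5) (`|C| ≤ 1`, range `rC`); a junction
    --      rate `μΔ`; the letter match with `rf`; and `lamD.toC.KK Z t` IS `Cᵀ·sDecorate(J′, ½raw ⊕ ½rawᵀ)·C` (`hKK`)
    {ρΔ BΔ ηΔ μΔ M₁ rC : ℝ} {mF c₀ : ℕ}
    (hEL : ∀ Z, ∀ t ∈ terms (θ.ℓ₆ + 1) (lamD.toC.toK.layer.m₃ + 1) Z, RawEntryLetters (lamD.Δ₀ Z t) (lamD.locF Z t) rf.R ρΔ BΔ)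
    -- (3‴) the fine-bond fibre bound AS A LOCATED INEQUALITY (`B13CondTowerLocationNumerals.locFFibreMax`)
    (hmF : locFFibreMax lamD ≤ mF)
    -- (3‴) the cube decoration's geodesic letter `hGJ` AS ITS TWO LAWS (symmetry of `J`; a decorated pair is joined by a `d₁`-geodesic through the
    --      σ-region `X`) + ONE LOCATED INEQUALITY on the cardinal excess (`B13CondTowerLocationNumerals.decorExcess`); the slope `0 < M₁` is
    --      derived below from `hκ₁ hκp hP2 hηΔ` (no binder)
    (hsymm : ∀ (Z : TDom 4 (lamD.n + 1)) (t : B13TermIdx θ lamD.n lamD.m₃) (i j : lamD.P Z t), lamD.J Z t (j, i) = lamD.J Z t (i, j))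
    (hthrough : ∀ (Z : TDom 4 (lamD.n + 1)) (t : B13TermIdx θ lamD.n lamD.m₃) (i j : lamD.P Z t), (lamD.J Z t (i, j)).Nonempty →
      ∃ z ∈ lamD.X Z t, tdist1 lamD.Nf (lamD.locF Z t i) z + tdist1 lamD.Nf z (lamD.locF Z t j)
        ≤ tdist1 lamD.Nf (lamD.locF Z t i) (lamD.locF Z t j))
    (hc₀ : decorExcess lamD M₁ ≤ c₀)
    (hηΔ : 0 < ηΔ) (hP2 : 2 * cp.κ₁ ≤ ηΔ * M₁)
    -- (3‴) the averaging operator's size and range AS TWO LOCATED INEQUALITIES (`B13CondTowerLocationNumerals.cmAbsMax ∕ cmRange`)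
    (hCmax : (cmAbsMax lamD : ℝ) ≤ 1)
    (hrC : (cmRange lamD : ℝ) ≤ rC) (hμΔ : 0 < μΔ)
    -- (3″) THE (1.11) NUMERICS + JUNCTION-RATE CHAIN AS n10-w3's LOCATED NUMERALS (`B13EntrywiseBlockNumerals`, dial form):
    --      ONE rate budget and ONE floor replace `εΔ κΔ hηε hρε hμε hμκ hκεΔ hεP hkapP hKP`
    (hbudget : ηΔ + rf.εP + rf.kapP + 4 * μΔ ≤ ρΔ)
    (hkbar : kbarFloor lamD.toC.toK.ν mF c₀ ρΔ ηΔ μΔ rC cp.κ₁ BΔ ≤ rf.KbarP)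
    -- (3‴) THE ONE POSITIVITY `hKacc` AS A LOCATED INEQUALITY (n10-w4 g3 `B13CondTowerAccretiveFloorMax.accretiveFloorMax`, the OPTIMAL floor):
    --      the rung's reference margin `rf.m₀` is at most the LARGEST uniform real Rayleigh floor of the record's positive definite reference values
    --      `K₀ Z t` — EQUIVALENT to the real-floor form of `hKacc` (`le_accretiveFloorMax_iff`); any known uniform floor `γ ≥ rf.m₀` discharges it
    (hm₀ : rf.m₀ ≤ accretiveFloorMax lamD.toC)
    -- (3‴) the far-ness `hKfar` and the multiplicity `hKmult` AS LOCATED INEQUALITIES (`B13CondTowerLocationNumerals.sigmaDistFloor ∕ locNFibreMax`)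
    (hRσfloor : rf.Rσ ≤ sigmaDistFloor lamD.toC)
    (hnB : locNFibreMax lamD.toC ≤ rf.nB)
    (hKdim : lamD.toC.toK.ν ≤ rf.dm) (hεL : rf.εL ≤ rf.εP) (hκL : rf.kapL ≤ rf.kapP) (hKL : rf.KbarP ≤ rf.KbarL) (hεA : rf.εA ≤ rf.εP)
    (hκA : rf.kapA ≤ rf.kapP) (hKA : rf.KbarP ≤ rf.KbarA) (hmA : rf.mA₀ ≤ rf.m₀)
    -- (3) THE (2.24)–(2.25) SMALLNESS AS n10-w1's THREE LOCATED NUMERALS (`B13Bound226Numerals`: canonical rate chain `j·κ_C⋆∕5`,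
    --     `ϑ := theta`, `K_G := K̄`, `K_Cs := 8∕m_{A,0}`, `c_E := 2∕m_{A,0}`): `θ₀ ≤ θ₀max`, `γ₂ ≤ γ₂max`, `M⁴min ≤ M⁴`
    (hγle : γ₂ ≤ gamma2Max m lamD.toC.toK.ν (2 / rf.mA₀) (rf.toWalkPackage R₁).BΓ rf.cV (B6.c0 1 rf.η) rf.mA₀)
    (hM4 : m4Min m lamD.toC.toK.ν m' (2 / rf.mA₀) (rf.toWalkPackage R₁).BΓ rf.cV (B6.c0 1 rf.η) rf.mA₀ lamD.toC.toK.layer.c.α₄ lamD.toC.toK.layer.c.κ₁ ≤ lamD.toC.toK.layer.c.M ^ 4)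
    -- (3) constant matching, p. 17: `a ≤ γ₂ r_P²` and the volume factor with `w = 2·K₀(64,8)·α₄·#(⋃𝐃)`
    (hPa : a ≤ γ₂ * lamD.toC.toK.rP ^ 2)
    -- (3) ★ (67V) THE VOLUME BINDER IN ITS DIAL-WEIGHTED FORM ((2.24)–(2.26); p. 20 «O(1)(LM)⁴α₅ … sufficiently small»): the text of
    --     `…EntrywiseDecorated`'s `hvol` at w1's canonical letters (rates `chainRate j κ_C⋆`, `ϑ := theta … θ₀`, `K_G := K̄`, `K_Cs := 8∕m_{A,0}`,
    --     `c_E := 2∕m_{A,0}`) — per-row-bond coefficients PROPORTIONAL TO THE DIALS `θ₀`, `γ₂`, `α₄M⁻⁴`, NOT frozen at `2, ½` (67's `hcount`;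
    --     `B13CountBinderObstruction`: with the frozen form no typed constants family carries a joint inhabitant)
    (hvol : ∀ Z, ∀ t ∈ terms (θ.ℓ₆ + 1) (lamD.toC.toK.layer.m₃ + 1) Z,
      2 * (8 / rf.mA₀ * (m * (1 + 2 / chainRate 3 (rf.toWalkPackage R₁).kapCStar) ^ lamD.toC.toK.ν) * (theta m lamD.toC.toK.ν (rf.toWalkPackage R₁).kapCStar (rf.toWalkPackage R₁).Kbar (8 / rf.mA₀) θ₀ * (m * (1 + 2 / chainRate 1 (rf.toWalkPackage R₁).kapCStar) ^ lamD.toC.toK.ν))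
              * (1 + (1 - 8 / rf.mA₀ * (m * (1 + 2 / chainRate 3 (rf.toWalkPackage R₁).kapCStar) ^ lamD.toC.toK.ν) * (theta m lamD.toC.toK.ν (rf.toWalkPackage R₁).kapCStar (rf.toWalkPackage R₁).Kbar (8 / rf.mA₀) θ₀ * (m * (1 + 2 / chainRate 1 (rf.toWalkPackage R₁).kapCStar) ^ lamD.toC.toK.ν)))⁻¹) / 2)
          * (Fintype.card (lamD.toC.toK.𝒦 Z t).Λ : ℝ)
        + 2 * (K₀ 64 8 * lamD.toC.toK.layer.c.α₄ * ((((t.1).image Subtype.val).biUnion id).card : ℝ))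
        + (2 * (theta m lamD.toC.toK.ν (rf.toWalkPackage R₁).kapCStar (rf.toWalkPackage R₁).Kbar (8 / rf.mA₀) θ₀ * (m * (1 + 2 / chainRate 1 (rf.toWalkPackage R₁).kapCStar) ^ lamD.toC.toK.ν)) +
            (γ₂ + 2 * (m' * lamD.toC.toK.layer.c.α₄ * (lamD.toC.toK.layer.c.M ^ 4)⁻¹ * (1 + 32 / (lamD.toC.toK.layer.c.κ₁ - 1)) ^ 4))) * (2 / rf.mA₀) * (Fintype.card (lamD.toC.toK.𝒦 Z t).Λ : ℝ)
        + (2 * (theta m lamD.toC.toK.ν (rf.toWalkPackage R₁).kapCStar (rf.toWalkPackage R₁).Kbar (8 / rf.mA₀) θ₀ * (m * (1 + 2 / chainRate 1 (rf.toWalkPackage R₁).kapCStar) ^ lamD.toC.toK.ν)) +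
            (γ₂ + 2 * (m' * lamD.toC.toK.layer.c.α₄ * (lamD.toC.toK.layer.c.M ^ 4)⁻¹ * (1 + 32 / (lamD.toC.toK.layer.c.κ₁ - 1)) ^ 4))) * (1 + 2 * (2 / rf.mA₀) * (((rf.toWalkPackage R₁).BΓ * rf.cV) * ((rf.toWalkPackage R₁).BΓ * (m * B6.c0 1 rf.η ^ lamD.toC.toK.ν)) / (rf.mA₀ / 2)))
            * (Fintype.card ((lamD.toC.toK.𝒦 Z t).Λ ⊕ (lamD.toC.toK.𝒦 Z t).C₀) : ℝ)
        ≤ a₅ * ((Z.1).card : ℝ)) :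
    B13LeafOfRecord θ lamD.toC.toK.layer := by
  -- (67RDL) the decoration slope is positive: `0 < 1 + 2·log(8·12³) ≤ κ₁ < cp.κ₁` and `2·cp.κ₁ ≤ η_Δ·M₁` with `0 < η_Δ`
  have hM₁ : 0 < M₁ := by
    have hlog : 0 ≤ Real.log (8 * 12 ^ 3) := Real.log_nonneg (by norm_num)
    have hpos : 0 < ηΔ * M₁ := by linarith only [hP2, hκp, hκ₁, hlog]
    exact pos_of_mul_pos_right hpos hηΔ.le
  -- (67RD, free θ₀) the package at the located radius is admissible; its numerals are signed; `0 < θ₀ ≤ θ₀max ≤ 1 < 4K̄+4`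
  have hR₁pos : 0 < R₁ := hR₁def ▸ radiusStar_pos hrf.hR hrf.hm₀ hrf.hmA₀ hrf.hKbarP hrf.hKbarA (cV_nonneg hrf) (cV₀_nonneg hrf)
  have hq := admissible_toWalkPackage hrf hR₁pos
  have hκs : 0 < (rf.toWalkPackage R₁).kapCStar := (kapCStar_spec hq (rhoE_pos hp) (mu_pos hq hp)).1
  have hKbar : 0 ≤ (rf.toWalkPackage R₁).Kbar := Kbar_nonneg hq
  have hmA0 : 0 < rf.mA₀ := hrf.hmA₀
  have hQ := coefQ_nonneg m lamD.toC.toK.ν (κs := (rf.toWalkPackage R₁).kapCStar) (KG := (rf.toWalkPackage R₁).Kbar)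
    (div_nonneg (by norm_num : (0:ℝ) ≤ 8) hmA0.le)
  have hQ' := coefQ'_nonneg m lamD.toC.toK.ν (KG := (rf.toWalkPackage R₁).Kbar) (KCs := 8 / rf.mA₀) hκs
  have hD := (dSum_pos_and_le m lamD.toC.toK.ν (BΓ := (rf.toWalkPackage R₁).BΓ) (div_nonneg (by norm_num : (0:ℝ) ≤ 2) hmA0.le) (cV_nonneg hrf)
    (RefPackage.c0_nonneg hrf.hη) hmA0).1
  have hθ1 : θ₀ ≤ 1 := le_trans hθle (theta0Max_le_one_of_signs hQ hQ' hD)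
  have hθ4 : θ₀ < 4 * (rf.toWalkPackage R₁).Kbar + 4 := by linarith only [hθ1, hKbar]
  -- the nine dial binders at `R₁⋆` and the FREE `θ₀` from the two located inequalities (`B13RungDialNumerals.rung_dials_at`)
  have hd := rung_dials_at (mu := (rf.toWalkPackage R₁).mu) (kapC := (rf.toWalkPackage R₁).kapCStar) hrf.hR hrf.hm₀ hmA0 hrf.hKbarP hrf.hKbarA
    (cV_nonneg hrf) (cV₀_nonneg hrf) hp.hεP hp.hεA hKbar hθ4 (hR₁def ▸ hαloc) hRσloc
  rw [← hR₁def] at hd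
  -- (67R) NODE A's eleven junction-rate binders from ONE budget and ONE floor (`B13EntrywiseBlockNumerals.numerals_nodeA_of_dials`)
  obtain ⟨εΔ, κΔ, -, hηε, hρε, -, -, hμε, hμκ, hκεΔ, hεP, hkapP, hKP⟩ :=
    numerals_nodeA_of_dials (ν := lamD.toC.toK.ν) (mF := mF) (c₀ := c₀) (rC := rC) (BΔ := BΔ)
      hηΔ hP2 hμΔ hrf.hεP hrf.hkapP.le hbudget hkbar
  -- (64 ∕ 67) n10-w1's located numerals: the canonical rate chain, `ϑ := theta`, `hθR1le hsmallKθ hc0 hαc hsmall` — and NOT `vol_of_counts`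
  obtain ⟨hk0, hk1, hk2, hk3, hk4, hθ₀le, hθR1le, hsmallKθ, hc0, hαc, hsmall⟩ :=
    numerals_226_canonical m lamD.toC.toK.ν m' hκs hKbar hθ₀.le (cV_nonneg hrf) (RefPackage.c0_nonneg hrf.hη) hrf.hmA₀ hγ₂ hα.le hM
      hθle hγle hM4
  -- `…EntrywiseDecorated` positionally: the eight located-object binders from n10-w4's supply lemmas BY NAME, the volume binder passed THROUGH
  exact b13LeafOfRecord_decLayer_of_located_entrywise θ lamD
    hN12 dist hS0Y hFsub hSq hScY hdist0 hdist hSX hSX' hX0 hAnT hAnT' hK hK' hκ hδ1 hδκ hκ126 hκ126' hκ₁ hκ₁' hδ₀M hδ₀M5 hR8 hR9 h124 h130 hθ₁0 hθ₁1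
    hC hGlAn hGl he hg hK₂ hR hε3 hW hKW hcard hsp hfloor hAnP hG hL8 hN h12 hE hε hC₁ hα hM hτ2 cp hκp hr hr1 hαnn huα hPcard ιb hι cube hQsupp hfibc
    hBv hBv0 hχsupp hVm hsmallm hγ₂ (hfibN_decTower_of_le lamD hm) rf hrf hd.1 hd.2.1 hd.2.2.1 hd.2.2.2.1 hd.2.2.2.2.1 hd.2.2.2.2.2.1 hp hη
    hd.2.2.2.2.2.2.1 hKX hEL (hfibF_of_locFFibreMax_le lamD hmF) (hGJ_of_laws_of_decorExcess_le lamD hsymm hthrough hM₁ hc₀) hηΔ hηε hρε hP2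
    (hCle_of_cmAbsMax_le_one lamD hCmax) (hCsupp_of_cmRange_le lamD hrC) hμΔ hμε hμκ hκεΔ hεP hkapP hKP
    (hKacc_decTower_of_le_accretiveFloorMax lamD hm₀) (hKfar_decTower_of_le lamD rf hRσfloor) (hKmult_decTower_of_le lamD rf hnB) hKdim hεL hκL hKL
    hεA hκA hKA hmA le_rfl le_rfl hθ₀ hd.2.2.2.2.2.2.2.1 hd.2.2.2.2.2.2.2.2 hk0 hk1 hk2 hk3 hk4 hθ₀le hθR1le hsmallKθ hc0 le_rfl hαc hsmall hPa hvol

end DecLayer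

end Summit.QuantumFields.YangMills.BalabanUVNodes.N10B13KernelTowerWalksEntrywiseNumeralsDecoratedDialsLocatedVol

end
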